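import Mathlib.Analysis.Calculus.LocalExtr.Basic
import Mathlib.Analysis.Calculus.Deriv.Mul
import Mathlib.Topology.Order.Compact
import Mathlib.Analysis.Convex.Basic
import Mathlib.Topology.Instances.Real.Lemmas
import HarnessLib

/-!
# The touching (weighted maximum-principle) lemma for scalar transport `c y′ = β y − h`
# with a positive barrier, and attainment of the weighted supremum on half-lines

Topic `Literature/Analysis/ODE` (namespace `Literature.Analysis.ODE`). The elementary COMPARISON step behind every
weighted sup-norm ("barrier") a-priori estimate for real first-order linear systems whose equations are written in
characteristic form, one derivative per equation:

* `barrier_touching` — let `yb > 0` be a `C¹` barrier on `[x₁, x₂]` and let `y` solve `c y′ = β y − h` at a point `x⋆`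
  where the gauge `|y|/yb` is MAXIMAL on `[x₁, x₂]`, with value `θ`. If `x⋆` is interior, or is the left endpoint with
  `c(x⋆) ≥ 0`, or the right endpoint with `c(x⋆) ≤ 0` (the characteristic LEAVES the interval there), then
  `θ · (β yb − c yb′)(x⋆) ≤ |h(x⋆)|` (Fermat, resp. one-sided Fermat, applied to `±y − θyb ≤ 0`). With a coupled system one
  takes `θ` = the largest of all gauges, bounds `|h(x⋆)|` by `θ`·(couplings·barriers) + sources, and reads off
  `θ ≤ 1` as soon as every barrier inequality `β yb − c yb′ − Σ|couplings| yb_other ≥ source envelope` holds — no sign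
  condition on `c` in the interior (degenerate / sonic points cost nothing), data only at INFLOW endpoints.
* `exists_isMaxOn_Ici_of_tendsto_zero` / `exists_isMaxOn_Iic_of_tendsto_zero` — a continuous non-negative gauge
  tending to `0` at `+∞` (resp. `−∞`) attains its supremum on `[a, ∞)` (resp. `(−∞, a]`), so the touching point exists
  on half-lines once the barrier grows at infinity.

## References

* M. H. Protter, H. F. Weinberger, *Maximum Principles in Differential Equations*, Springer 1984, Ch. 1 (the
  one-dimensional maximum principle and its generalised, weighted form `u/w`). Key `ProtterWeinberger1984`.
* P. Hartman, *Ordinary Differential Equations*, 2nd ed., SIAM 2002, Ch. III (differential inequalities). Key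
  `Hartman2002`.
-/

noncomputable section

open Set Filter Topology

namespace Literature.Analysis.ODE

/-- **The touching lemma (generalised one-dimensional maximum principle).** Let `yb > 0` on `[x₁, x₂]`, let `y`, `yb`
be differentiable at a point `x⋆ ∈ [x₁, x₂]` where `|y|/yb` attains its maximum over `[x₁, x₂]`, and let
`c(x⋆) y′(x⋆) = β(x⋆) y(x⋆) − h(x⋆)`. If `x⋆ = x₁ ⇒ c(x⋆) ≥ 0` and `x⋆ = x₂ ⇒ c(x⋆) ≤ 0` (no inflow endpoint), then
`(|y(x⋆)|/yb(x⋆)) · (β(x⋆) yb(x⋆) − c(x⋆) yb′(x⋆)) ≤ |h(x⋆)|`: with `σ = sign y(x⋆)` the function `σy − θyb ≤ 0` vanishes at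
`x⋆`, so `c(x⋆)(σy′ − θyb′)(x⋆) ≤ 0` by Fermat (interior) or one-sided Fermat (outflow endpoint), and the equation gives
`θ(βyb − cyb′) ≤ σh ≤ |h|`. [cite: ProtterWeinberger1984, Ch. 1, Thm 1 and §5] -/
theorem barrier_touching {c β h y y' yb yb' : ℝ → ℝ} {x₁ x₂ xs : ℝ} (hxs : xs ∈ Icc x₁ x₂)
    (hy : HasDerivAt y (y' xs) xs) (hyb : HasDerivAt yb (yb' xs) xs) (hpos : ∀ x ∈ Icc x₁ x₂, 0 < yb x)
    (hmax : IsMaxOn (fun x => |y x| / yb x) (Icc x₁ x₂) xs) (hode : c xs * y' xs = β xs * y xs - h xs)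
    (hleft : xs = x₁ → 0 ≤ c xs) (hright : xs = x₂ → c xs ≤ 0) :
    |y xs| / yb xs * (β xs * yb xs - c xs * yb' xs) ≤ |h xs| := by
  set θ : ℝ := |y xs| / yb xs with hθ
  have hybs : 0 < yb xs := hpos xs hxs
  -- the sign of `y(x⋆)`
  obtain ⟨σ, hσ1, hσy⟩ : ∃ σ : ℝ, (σ = 1 ∨ σ = -1) ∧ σ * y xs = |y xs| := by
    rcases le_or_gt 0 (y xs) with h0 | h0
    · exact ⟨1, Or.inl rfl, by rw [one_mul, abs_of_nonneg h0]⟩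
    · exact ⟨-1, Or.inr rfl, by rw [abs_of_neg h0]; ring⟩
  have hσabs : ∀ t : ℝ, σ * t ≤ |t| := by
    intro t
    rcases hσ1 with h1 | h1
    · rw [h1, one_mul]; exact le_abs_self t
    · rw [h1, neg_one_mul]; exact neg_le_abs t
  -- the touching function `φ = σ y − θ yb ≤ 0`, `φ(x⋆) = 0`
  set φ : ℝ → ℝ := fun x => σ * y x - θ * yb x with hφ
  have hφle : ∀ x ∈ Icc x₁ x₂, φ x ≤ 0 := by
    intro x hx
    have h1 : |y x| / yb x ≤ θ := hmax hx
    have h2 : |y x| ≤ θ * yb x := by rwa [div_le_iff₀ (hpos x hx)] at h1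
    have h3 := hσabs (y x)
    simp only [hφ]
    linarith
  have hφs : φ xs = 0 := by
    simp only [hφ, hθ]
    rw [hσy, div_mul_cancel₀ _ hybs.ne']
    ring
  have hφd : HasDerivAt φ (σ * y' xs - θ * yb' xs) xs := (hy.const_mul σ).sub (hyb.const_mul θ)
  have hmaxφ : IsMaxOn φ (Icc x₁ x₂) xs := fun x hx => by
    have := hφle x hx
    simp only [mem_setOf_eq, hφs]
    exact this
  -- the key sign: `c(x⋆) φ′(x⋆) ≤ 0`
  have key : c xs * (σ * y' xs - θ * yb' xs) ≤ 0 := by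
    rcases eq_or_lt_of_le hxs.1 with h1 | h1
    · -- `x⋆ = x₁`
      have hc : 0 ≤ c xs := hleft h1.symm
      rcases eq_or_lt_of_le hxs.2 with h2 | h2
      · -- degenerate interval: `c(x⋆) = 0`
        have hc' : c xs ≤ 0 := hright h2
        have : c xs = 0 := le_antisymm hc' hc
        rw [this, zero_mul]
      · have hyv : x₂ - xs ∈ posTangentConeAt (Icc x₁ x₂) xs :=
          sub_mem_posTangentConeAt_of_segment_subset
            ((convex_Icc x₁ x₂).segment_subset hxs (right_mem_Icc.2 (hxs.1.trans hxs.2)))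
        have hF := hmaxφ.localize.hasFDerivWithinAt_nonpos hφd.hasDerivWithinAt.hasFDerivWithinAt hyv
        simp only [ContinuousLinearMap.toSpanSingleton_apply, smul_eq_mul] at hF
        have hφ' : σ * y' xs - θ * yb' xs ≤ 0 := by nlinarith
        exact mul_nonpos_of_nonneg_of_nonpos hc hφ'
    · rcases eq_or_lt_of_le hxs.2 with h2 | h2
      · -- `x⋆ = x₂`
        have hc : c xs ≤ 0 := hright h2
        have hyv : x₁ - xs ∈ posTangentConeAt (Icc x₁ x₂) xs :=
          sub_mem_posTangentConeAt_of_segment_subset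
            ((convex_Icc x₁ x₂).segment_subset hxs (left_mem_Icc.2 (hxs.1.trans hxs.2)))
        have hF := hmaxφ.localize.hasFDerivWithinAt_nonpos hφd.hasDerivWithinAt.hasFDerivWithinAt hyv
        simp only [ContinuousLinearMap.toSpanSingleton_apply, smul_eq_mul] at hF
        have hφ' : 0 ≤ σ * y' xs - θ * yb' xs := by nlinarith
        exact mul_nonpos_of_nonpos_of_nonneg hc hφ'
      · -- interior point: Fermat
        have hn : Icc x₁ x₂ ∈ 𝓝 xs := Icc_mem_nhds h1 h2
        have hzero := (hmaxφ.isLocalMax hn).hasDerivAt_eq_zero hφd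
        rw [hzero, mul_zero]
  -- conclude with the equation multiplied by `σ`
  have hode' : c xs * (σ * y' xs) = β xs * (σ * y xs) - σ * h xs := by
    calc c xs * (σ * y' xs) = σ * (c xs * y' xs) := by ring
      _ = σ * (β xs * y xs - h xs) := by rw [hode]
      _ = β xs * (σ * y xs) - σ * h xs := by ring
  have hθyb : θ * yb xs = |y xs| := by rw [hθ, div_mul_cancel₀ _ hybs.ne']
  have h1 : θ * (β xs * yb xs - c xs * yb' xs) = β xs * (σ * y xs) - c xs * (θ * yb' xs) := by
    rw [hσy, ← hθyb]; ring
  rw [h1]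
  have h2 : β xs * (σ * y xs) - c xs * (θ * yb' xs) = σ * h xs + c xs * (σ * y' xs - θ * yb' xs) := by
    rw [mul_sub (c xs), hode']; ring
  rw [h2]
  linarith [hσabs (h xs)]

/-- The same bound stated with the maximal gauge value `θ` as a separate variable: if `|y| ≤ θ yb` on `[x₁, x₂]` with
equality `|y(x⋆)| = θ yb(x⋆)` at an admissible touching point, then `θ (β yb − c yb′)(x⋆) ≤ |h(x⋆)|`.
[cite: ProtterWeinberger1984, Ch. 1, Thm 1 and §5] -/
theorem barrier_touching' {c β h y y' yb yb' : ℝ → ℝ} {x₁ x₂ xs θ : ℝ} (hxs : xs ∈ Icc x₁ x₂)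
    (hy : HasDerivAt y (y' xs) xs) (hyb : HasDerivAt yb (yb' xs) xs) (hpos : ∀ x ∈ Icc x₁ x₂, 0 < yb x)
    (hle : ∀ x ∈ Icc x₁ x₂, |y x| ≤ θ * yb x) (heq : |y xs| = θ * yb xs)
    (hode : c xs * y' xs = β xs * y xs - h xs) (hleft : xs = x₁ → 0 ≤ c xs) (hright : xs = x₂ → c xs ≤ 0) :
    θ * (β xs * yb xs - c xs * yb' xs) ≤ |h xs| := by
  have hybs : 0 < yb xs := hpos xs hxs
  have hθ : |y xs| / yb xs = θ := by rw [heq, mul_div_assoc, div_self hybs.ne', mul_one]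
  have hmax : IsMaxOn (fun x => |y x| / yb x) (Icc x₁ x₂) xs := by
    intro x hx
    simp only [mem_setOf_eq, hθ]
    rw [div_le_iff₀ (hpos x hx)]
    exact hle x hx
  have := barrier_touching hxs hy hyb hpos hmax hode hleft hright
  rwa [hθ] at this

/-- A continuous non-negative function on `[a, ∞)` tending to `0` at `+∞` attains its supremum on `[a, ∞)` (if it is
positive somewhere it is eventually smaller than that value; otherwise it vanishes identically). [folklore] -/
theorem exists_isMaxOn_Ici_of_tendsto_zero {g : ℝ → ℝ} {a : ℝ} (hg : ContinuousOn g (Ici a))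
    (hg0 : ∀ x ∈ Ici a, 0 ≤ g x) (hlim : Tendsto g atTop (𝓝 0)) : ∃ xs ∈ Ici a, IsMaxOn g (Ici a) xs := by
  by_cases hex : ∃ x₀ ∈ Ici a, 0 < g x₀
  · obtain ⟨x₀, hx₀, hgx₀⟩ := hex
    refine hg.exists_isMaxOn' isClosed_Ici hx₀ ?_
    have h1 : ∀ᶠ x in atTop, g x ≤ g x₀ := (hlim.eventually (gt_mem_nhds hgx₀)).mono fun x hx => hx.le
    have h2 : ∀ᶠ x in atBot ⊓ 𝓟 (Ici a), g x ≤ g x₀ := by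
      rw [eventually_inf_principal]
      filter_upwards [eventually_lt_atBot a] with x hx hxa
      exact absurd (mem_Ici.1 hxa) (not_le.2 hx)
    rw [cocompact_eq_atBot_atTop, inf_sup_right]
    exact eventually_sup.2 ⟨h2, h1.filter_mono inf_le_left⟩
  · push Not at hex
    refine ⟨a, self_mem_Ici, fun x hx => ?_⟩
    simp only [mem_setOf_eq]
    exact (hex x hx).trans (hg0 a self_mem_Ici)

/-- A continuous non-negative function on `(−∞, a]` tending to `0` at `−∞` attains its supremum on `(−∞, a]`.
[folklore] -/
theorem exists_isMaxOn_Iic_of_tendsto_zero {g : ℝ → ℝ} {a : ℝ} (hg : ContinuousOn g (Iic a))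
    (hg0 : ∀ x ∈ Iic a, 0 ≤ g x) (hlim : Tendsto g atBot (𝓝 0)) : ∃ xs ∈ Iic a, IsMaxOn g (Iic a) xs := by
  by_cases hex : ∃ x₀ ∈ Iic a, 0 < g x₀
  · obtain ⟨x₀, hx₀, hgx₀⟩ := hex
    refine hg.exists_isMaxOn' isClosed_Iic hx₀ ?_
    have h1 : ∀ᶠ x in atBot, g x ≤ g x₀ := (hlim.eventually (gt_mem_nhds hgx₀)).mono fun x hx => hx.le
    have h2 : ∀ᶠ x in atTop ⊓ 𝓟 (Iic a), g x ≤ g x₀ := by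
      rw [eventually_inf_principal]
      filter_upwards [eventually_gt_atTop a] with x hx hxa
      exact absurd (mem_Iic.1 hxa) (not_le.2 hx)
    rw [cocompact_eq_atBot_atTop, inf_sup_right]
    exact eventually_sup.2 ⟨h1.filter_mono inf_le_left, h2⟩
  · push Not at hex
    refine ⟨a, self_mem_Iic, fun x hx => ?_⟩
    simp only [mem_setOf_eq]
    exact (hex x hx).trans (hg0 a self_mem_Iic)

end Literature.Analysis.ODE

end
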